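import Mathlib
import Summits.AtomisticToContinuum.Crystallization.Theorems.GappedShellCensusCleanLimitsHaveWindowsDefs
import Summits.AtomisticToContinuum.Crystallization.Theorems.PhononSlackCertificatesPeriodicGivenLayeredWindowBounds
import Literature.MathematicalPhysics.StatisticalMechanics.LocalMatchingCompactness
import Literature.Geometry.DiscreteGeometry.KissingPatterns
import Summits.AtomisticToContinuum.Crystallization.Theorems.GappedShellCensusCleanLimitsHaveWindowsBallBoundarySum
import Summits.AtomisticToContinuum.Crystallization.Theorems.GappedShellCensusCleanLimitsHaveWindowsGridCount
import Summits.AtomisticToContinuum.Crystallization.Theorems.GappedShellCensusCleanLimitsHaveWindowsDefectLipschitz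

/-!
# Crux `GappedShellCensus.CleanLimitsHaveWindows` (stmt-AtomisticToContinuum-15932), line `Sketch`:
# stub `stub_closing` (density closing)

For a uniformly recurrent, relatively dense, everywhere-clean element `Z` of the hull of a sequence of
Lennard-Jones ground states, transversal coercivity on balls forces the transversal defect
`localDefect a Z p` to vanish at every site:

* (A) surface order from above: on `W = Z ∩ B̄(c, L)` the cut-and-paste bound (U)
  (`LayeredHull.stub_windowBounds`) and the ball boundary sum (`stub_ballBoundarySum`) give
  `Σ_W e_p(Z) ≤ 2E(#W) + O(L²)`, and coercivity gives `2E(#W) − CL² + κ Σ_W defect ≤ Σ_W e_p(Z)`, so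
  `κ Σ_W defect = O(L²)`;
* (B) recurrence transfer (`closing_shellEquiv`, `closing_recur`): a defect `η > 0` at one site reappears,
  up to `η/2` (`stub_defectLipschitz`), within bounded distance of every point of space;
* (C) volume order from below: a `2G'`-separated grid in `B̄(c, L/2)` (`stub_gridCount`) yields
  `≥ (L/(8G'))³` distinct sites of defect `≥ η/2` in `W`; `L³ ≲ L²` is absurd (`closing_endgame`).
-/

noncomputable section

namespace Summit.AtomisticToContinuum.Crystallization.Theorems.CleanHull

open Filter Literature.MathematicalPhysics.StatisticalMechanics Literature.Geometry.DiscreteGeometry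

/-- **Endgame arithmetic.** `A L³ ≤ M L²` for all `L ≥ L₀ > 0` with `A > 0` is absurd
(take `L = max L₀ (M/A + 1)`). [folklore] -/
theorem closing_endgame {A M L₀ : ℝ} (hA : 0 < A) (hL₀ : 0 < L₀)
    (h : ∀ L : ℝ, L₀ ≤ L → A * L ^ 3 ≤ M * L ^ 2) : False := by
  have hL : L₀ ≤ max L₀ (M / A + 1) := le_max_left _ _
  have hL' : M / A + 1 ≤ max L₀ (M / A + 1) := le_max_right _ _
  have h1 := h _ hL
  have h3 : M < A * max L₀ (M / A + 1) := by
    rw [mul_comm]; exact (div_lt_iff₀ hA).1 (by linarith)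
  have h4 := mul_lt_mul_of_pos_right h3 (pow_pos (hL₀.trans_le hL) 2)
  have h5 : A * max L₀ (M / A + 1) * max L₀ (M / A + 1) ^ 2 = A * max L₀ (M / A + 1) ^ 3 := by ring
  linarith

/-- **Shell transport along a matching.** If `Z` is gapped-twelve at scale `a`, `p₀, p' ∈ Z`, and the
translate `Z - g` is `ε`-matched onto the bond shell of `p₀` with `p' - g` within `ε` of `p₀` (`2ε ≤ a/50`),
then the matching is a bijection between the bond shells of `p₀` and `p'` moving relative positions by
`≤ 2ε` (the gap clause puts matched points in the shell; separation makes the map injective; both shells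
have twelve points). [folklore] -/
theorem closing_shellEquiv {Z : Set (EuclideanSpace ℝ (Fin 3))} {a ε : ℝ} (ha : 0 < a) (hεa : 2 * ε ≤ a / 50)
    (hgap : ∀ y ∈ Z, {w ∈ Z | w ≠ y ∧ dist y w ≤ a * (1 + 1 / 50)}.ncard = 12 ∧
      ∀ w ∈ Z, w ≠ y → a * (1 - 1 / 50) ≤ dist y w ∧
        (dist y w ≤ a * (1 + 1 / 50) ∨ a * (63 / 50) ≤ dist y w))
    {p₀ p' g : EuclideanSpace ℝ (Fin 3)} (hp₀ : p₀ ∈ Z) (hp' : p' ∈ Z) (hpp : dist (p' - g) p₀ ≤ ε)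
    (hmatch : ∀ w ∈ bondShell a Z p₀, ∃ w' ∈ Z, dist (w' - g) w ≤ ε) :
    ∃ f : ↥(bondShell a Z p₀) ≃ ↥(bondShell a Z p'),
      ∀ w : ↥(bondShell a Z p₀),
        dist ((f w : EuclideanSpace ℝ (Fin 3)) - p') ((w : EuclideanSpace ℝ (Fin 3)) - p₀) ≤ 2 * ε := by
  choose! φ hφZ hφd using hmatch
  -- distances to the centre move by at most `2ε`
  have hdd : ∀ w ∈ bondShell a Z p₀, |dist p' (φ w) - dist p₀ w| ≤ 2 * ε := fun w hw => by
    rw [← Real.dist_eq, ← dist_sub_right p' (φ w) g]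
    linarith [dist_dist_dist_le (p' - g) (φ w - g) p₀ w, hφd w hw]
  have hmem : ∀ w ∈ bondShell a Z p₀, φ w ∈ bondShell a Z p' := fun w hw => by
    have h1 := abs_le.1 (hdd w hw)
    obtain ⟨hwZ, hwp, hwd⟩ := hw
    have hw' : w ∈ bondShell a Z p₀ := ⟨hwZ, hwp, hwd⟩
    have hlow := ((hgap p₀ hp₀).2 w hwZ hwp).1
    have hne : φ w ≠ p' := fun h => by
      rw [h, dist_self] at h1
      linarith [h1.1]
    refine ⟨hφZ w hw', hne, ?_⟩
    rcases ((hgap p' hp').2 (φ w) (hφZ w hw') hne).2 with h | h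
    · exact h
    · exfalso; linarith [h1.2]
  -- the induced map of shells is injective, hence bijective
  set f₀ : ↥(bondShell a Z p₀) → ↥(bondShell a Z p') := fun w => ⟨φ w, hmem w w.2⟩ with hf₀
  have hinj : Function.Injective f₀ := by
    rintro ⟨w₁, hw₁⟩ ⟨w₂, hw₂⟩ h
    have h' : φ w₁ = φ w₂ := congrArg Subtype.val h
    by_contra hne
    have hne' : w₁ ≠ w₂ := fun e => hne (Subtype.ext e)
    have hlow := ((hgap w₁ hw₁.1).2 w₂ hw₂.1 hne'.symm).1
    have : dist w₁ w₂ ≤ ε + ε :=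
      calc dist w₁ w₂ ≤ dist w₁ (φ w₁ - g) + dist (φ w₁ - g) w₂ := dist_triangle _ _ _
        _ ≤ ε + ε := add_le_add (by rw [dist_comm]; exact hφd w₁ hw₁) (by rw [h']; exact hφd w₂ hw₂)
    nlinarith
  have hcard : ∀ q ∈ Z, Nat.card ↥(bondShell a Z q) = 12 := fun q hq => by
    rw [Nat.card_coe_set_eq]; exact (hgap q hq).1
  haveI : Finite ↥(bondShell a Z p') := Nat.finite_of_card_ne_zero (by rw [hcard p' hp']; norm_num)
  have hbij : Function.Bijective f₀ :=
    hinj.bijective_of_nat_card_le (by rw [hcard p' hp', hcard p₀ hp₀])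
  refine ⟨Equiv.ofBijective f₀ hbij, fun w => ?_⟩
  rw [Equiv.ofBijective_apply]
  show dist (φ w - p') ((w : EuclideanSpace ℝ (Fin 3)) - p₀) ≤ 2 * ε
  calc dist (φ w - p') ((w : EuclideanSpace ℝ (Fin 3)) - p₀) = ‖(φ w - g - w) - (p' - g - p₀)‖ := by
        rw [dist_eq_norm]; congr 1; abel
    _ ≤ ‖φ w - g - w‖ + ‖p' - g - p₀‖ := norm_sub_le _ _
    _ ≤ ε + ε := by rw [← dist_eq_norm, ← dist_eq_norm]; exact add_le_add (hφd w w.2) hpp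
    _ = 2 * ε := by ring

/-- **Recurrence transfer of a positive defect.** If `Z` is gapped-twelve at scale `a > 0`, rooted-uniformly
recurrent and `2a`-relatively dense, and the transversal defect is `K`-Lipschitz under shell bijections,
then a defect `≥ η > 0` at one site of `Z` forces, within a uniform distance `D` of EVERY point of space,
a site of `Z` of defect `≥ η/2`. [folklore] -/
theorem closing_recur {Z : Set (EuclideanSpace ℝ (Fin 3))} {a : ℝ} (ha : 0 < a) (K : ℝ)
    (hK : ∀ (p p' : EuclideanSpace ℝ (Fin 3)) (ε : ℝ), 0 ≤ ε → ε ≤ a →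
      (∃ f : ↥(bondShell a Z p) ≃ ↥(bondShell a Z p'),
        ∀ w : ↥(bondShell a Z p),
          dist ((f w : EuclideanSpace ℝ (Fin 3)) - p') ((w : EuclideanSpace ℝ (Fin 3)) - p) ≤ ε) →
      |localDefect a Z p - localDefect a Z p'| ≤ K * ε)
    (hgap : ∀ y ∈ Z, {w ∈ Z | w ≠ y ∧ dist y w ≤ a * (1 + 1 / 50)}.ncard = 12 ∧
      ∀ w ∈ Z, w ≠ y → a * (1 - 1 / 50) ≤ dist y w ∧
        (dist y w ≤ a * (1 + 1 / 50) ∨ a * (63 / 50) ≤ dist y w))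
    (hrec : ∀ R ε : ℝ, 0 < ε → ∃ G : ℝ, ∀ w ∈ Z, ∃ g ∈ Z, dist g w ≤ G ∧
      BallMatch ε R 0 ((fun p => p - g) '' Z) Z)
    (hdense : ∀ y : EuclideanSpace ℝ (Fin 3), ∃ w ∈ Z, dist w y ≤ 2 * a)
    {p₀ : EuclideanSpace ℝ (Fin 3)} (hp₀ : p₀ ∈ Z) {η : ℝ} (hη : 0 < η)
    (hηp : η ≤ localDefect a Z p₀) :
    ∃ D : ℝ, 0 ≤ D ∧ ∀ y : EuclideanSpace ℝ (Fin 3),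
      ∃ p' ∈ Z, dist p' y ≤ D ∧ η / 2 ≤ localDefect a Z p' := by
  have hK' : 0 < max K 1 := lt_max_of_lt_right one_pos
  set ε := min (a / 100) (η / (4 * max K 1)) with hεdef
  have hε : 0 < ε := lt_min (by positivity) (by positivity)
  have hεa : ε ≤ a / 100 := min_le_left _ _
  have hεK : K * (2 * ε) ≤ η / 2 := by
    have h2 : K * (2 * ε) ≤ max K 1 * (2 * ε) := mul_le_mul_of_nonneg_right (le_max_left _ _) (by linarith)
    have h3 : max K 1 * ε ≤ max K 1 * (η / (4 * max K 1)) := mul_le_mul_of_nonneg_left (min_le_right _ _) hK'.le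
    have h4 : max K 1 * (η / (4 * max K 1)) = η / 4 := by field_simp
    nlinarith
  obtain ⟨G, hG⟩ := hrec (‖p₀‖ + 2 * a) ε hε
  obtain ⟨g₀, -, hg₀, -⟩ := hG p₀ hp₀
  refine ⟨G + ‖p₀‖ + 3 * a, by linarith [dist_nonneg.trans hg₀, norm_nonneg p₀], fun y => ?_⟩
  obtain ⟨w, hwZ, hwy⟩ := hdense y
  obtain ⟨g, -, hgw, hBM⟩ := hG w hwZ
  obtain ⟨q, ⟨p', hp'Z, rfl⟩, hqp⟩ := hBM.1 p₀ hp₀ (by rw [dist_zero_right]; linarith)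
  have hqp : dist (p' - g) p₀ ≤ ε := hqp
  have hmatch : ∀ w₁ ∈ bondShell a Z p₀, ∃ w' ∈ Z, dist (w' - g) w₁ ≤ ε := by
    intro w₁ hw₁
    have h1 := dist_triangle w₁ p₀ (0 : EuclideanSpace ℝ (Fin 3))
    rw [dist_zero_right p₀, dist_comm w₁ p₀] at h1
    obtain ⟨q, ⟨w', hw'Z, rfl⟩, hd⟩ := hBM.1 w₁ hw₁.1 (by linarith [hw₁.2.2])
    exact ⟨w', hw'Z, hd⟩
  obtain ⟨f, hf⟩ := closing_shellEquiv ha (by linarith) hgap hp₀ hp'Z hqp hmatch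
  have hlip := (abs_le.1 (hK p₀ p' (2 * ε) (by linarith) (by linarith) ⟨f, hf⟩)).2
  refine ⟨p', hp'Z, ?_, by linarith⟩
  have h1 : dist p' w ≤ ε + ‖p₀‖ + G :=
    calc dist p' w = ‖(p' - g - p₀) + p₀ + (g - w)‖ := by rw [dist_eq_norm]; congr 1; abel
      _ ≤ ‖p' - g - p₀‖ + ‖p₀‖ + ‖g - w‖ := norm_add₃_le
      _ ≤ ε + ‖p₀‖ + G := by rw [← dist_eq_norm, ← dist_eq_norm]; linarith
  linarith [dist_triangle p' w y]

/-- **Stub T3b (density closing).** For a uniformly recurrent, relatively dense, everywhere-clean element of the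
hull of a sequence of Lennard-Jones ground states, transversal coercivity on balls forces the transversal defect
to vanish identically: (U) (`LayeredHull.stub_windowBounds`, the only use of `hx`) bounds the site energies over
`Z ∩ B(c, L)` by `2E(#W) + C L²`, so the summed defect is `O(L²)`; but a positive defect at one site recurs, up
to `η/2`, within bounded distance of every point (continuity of `localDefect` in the cluster), hence the summed
defect is `Ω(L³)` on large balls. [folklore] -/
theorem stub_closing (x : (N : ℕ) → (Fin N → EuclideanSpace ℝ (Fin 3)))
    (hx : ∀ N, IsGroundState lennardJones (x N)) (Z : Set (EuclideanSpace ℝ (Fin 3))) (a : ℝ)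
    (ha : 47 / 50 ≤ a) (ha1 : a ≤ 1)
    (hH : ∀ R ε : ℝ, 0 < ε → ∃ᶠ N in Filter.atTop, ∃ t : EuclideanSpace ℝ (Fin 3),
      (∀ p ∈ Z, ‖p‖ ≤ R → ∃ i : Fin N, dist (x N i + t) p ≤ ε) ∧
      (∀ i : Fin N, ‖x N i + t‖ ≤ R → ∃ p ∈ Z, dist (x N i + t) p ≤ ε))
    (hclean : ∀ y ∈ Z, ({w ∈ Z | w ≠ y ∧ dist y w ≤ a * (1 + 1 / 50)}.ncard = 12 ∧
        ∀ w ∈ Z, w ≠ y → a * (1 - 1 / 50) ≤ dist y w ∧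
          (dist y w ≤ a * (1 + 1 / 50) ∨ a * (63 / 50) ≤ dist y w)) ∧
      ∃ T : Finset (EuclideanSpace ℝ (Fin 3)), (↑T : Set (EuclideanSpace ℝ (Fin 3))) =
          (fun w => a⁻¹ • (w - y)) '' {w ∈ Z | w ≠ y ∧ dist y w ≤ a * (1 + 1 / 50)} ∧
        (ShellCloseTo (1 / 5) T fccKissingPattern ∨ ShellCloseTo (1 / 5) T hcpKissingPattern))
    (hrec : ∀ R ε : ℝ, 0 < ε → ∃ G : ℝ, ∀ w ∈ Z, ∃ g ∈ Z, dist g w ≤ G ∧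
      BallMatch ε R 0 ((fun p => p - g) '' Z) Z)
    (hdense : ∀ y : EuclideanSpace ℝ (Fin 3), ∃ w ∈ Z, dist w y ≤ 2 * a)
    (hcoer : ∃ κ C : ℝ, 0 < κ ∧ ∀ (Z : Set (EuclideanSpace ℝ (Fin 3))) (a : ℝ), 47 / 50 ≤ a → a ≤ 1 →
      (∀ y ∈ Z, ({w ∈ Z | w ≠ y ∧ dist y w ≤ a * (1 + 1 / 50)}.ncard = 12 ∧
          ∀ w ∈ Z, w ≠ y → a * (1 - 1 / 50) ≤ dist y w ∧
            (dist y w ≤ a * (1 + 1 / 50) ∨ a * (63 / 50) ≤ dist y w)) ∧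
        ∃ T : Finset (EuclideanSpace ℝ (Fin 3)), (↑T : Set (EuclideanSpace ℝ (Fin 3))) =
            (fun w => a⁻¹ • (w - y)) '' {w ∈ Z | w ≠ y ∧ dist y w ≤ a * (1 + 1 / 50)} ∧
          (ShellCloseTo (1 / 5) T fccKissingPattern ∨ ShellCloseTo (1 / 5) T hcpKissingPattern)) →
      ∀ (c : EuclideanSpace ℝ (Fin 3)) (L : ℝ), 1 ≤ L → ∀ W : Finset (EuclideanSpace ℝ (Fin 3)),
        (↑W : Set (EuclideanSpace ℝ (Fin 3))) = Z ∩ Metric.closedBall c L →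
        2 * groundStateEnergy lennardJones 3 W.card - C * L ^ 2 + κ * ∑ p ∈ W, localDefect a Z p ≤
          ∑ p ∈ W, siteEnergy Z p) :
    ∀ p ∈ Z, localDefect a Z p = 0 := by
  classical
  intro p₀ hp₀
  by_contra hne0
  have hη : 0 < localDefect a Z p₀ := lt_of_le_of_ne (localDefect_nonneg a Z p₀) (Ne.symm hne0)
  have ha0 : 0 < a := by linarith
  have hsep : ∀ p ∈ Z, ∀ q ∈ Z, p ≠ q → a * (1 - 1 / 50) ≤ dist p q :=
    fun p hp q hq hpq => ((hclean p hp).1.2 q hq hpq.symm).1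
  -- constants
  obtain ⟨κ, C, hκ, hco⟩ := hcoer
  obtain ⟨CU, hU⟩ := LayeredHull.stub_windowBounds.1
  obtain ⟨CB, hB⟩ := stub_ballBoundarySum (a * (1 - 1 / 50)) (by positivity)
  obtain ⟨K, hK⟩ := stub_defectLipschitz a ha0
  -- (A) the summed defect over balls is of surface order
  have hA : ∀ (c : EuclideanSpace ℝ (Fin 3)) (L : ℝ), 1 ≤ L → ∀ W : Finset (EuclideanSpace ℝ (Fin 3)),
      (↑W : Set (EuclideanSpace ℝ (Fin 3))) = Z ∩ Metric.closedBall c L →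
      κ * ∑ p ∈ W, localDefect a Z p ≤ (C + max CU 0 * CB) * L ^ 2 := by
    intro c L hL W hW
    have hout : ∃ q ∈ Z, L < dist q c := by
      obtain ⟨w, hw, hwd⟩ := hdense (c + EuclideanSpace.single 0 (L + 3))
      refine ⟨w, hw, ?_⟩
      have h1 : dist (c + EuclideanSpace.single 0 (L + 3)) c = L + 3 := by
        rw [dist_eq_norm, add_sub_cancel_left, PiLp.norm_single, Real.norm_eq_abs,
          abs_of_nonneg (by linarith)]
      linarith [dist_triangle_left (c + EuclideanSpace.single 0 (L + 3)) c w]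
    have hWZ : (↑W : Set (EuclideanSpace ℝ (Fin 3))) ⊆ Z := hW ▸ Set.inter_subset_left
    have h1 := hB Z hsep c L hL hout W hW
    have h2 := hU x hx Z hH W hWZ
    have h3 := hco Z a ha ha1 hclean c L hL W hW
    have h0 : 0 ≤ ∑ p ∈ W, (1 + Metric.infDist p (Z \ (↑W : Set (EuclideanSpace ℝ (Fin 3)))))⁻¹ ^ 3 :=
      Finset.sum_nonneg fun p _ =>
        pow_nonneg (inv_nonneg.2 (add_nonneg zero_le_one Metric.infDist_nonneg)) 3
    have h4 : CU * ∑ p ∈ W, (1 + Metric.infDist p (Z \ (↑W : Set (EuclideanSpace ℝ (Fin 3)))))⁻¹ ^ 3 ≤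
        max CU 0 * (CB * L ^ 2) :=
      (mul_le_mul_of_nonneg_right (le_max_left CU 0) h0).trans
        (mul_le_mul_of_nonneg_left h1 (le_max_right CU 0))
    simp only [siteEnergy] at h3
    nlinarith
  -- (B) recurrence transfer: sites of defect `≥ η/2` within distance `D` of every point
  obtain ⟨D, hD0, hD⟩ := closing_recur ha0 K (fun p p' ε h0 h1 hf => hK Z Z p p' ε h0 h1 hf)
    (fun y hy => (hclean y hy).1) hrec hdense hp₀ hη le_rfl
  choose φ hφZ hφd hφη using hD
  -- (C) counting on large balls about `0`
  have hG' : 1 ≤ D + 1 := by linarith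
  refine closing_endgame (A := κ * (localDefect a Z p₀ / 2) / (8 * (D + 1)) ^ 3)
    (M := C + max CU 0 * CB) (L₀ := 8 * (D + 1)) (by positivity) (by positivity) fun L hL => ?_
  obtain ⟨P, hPball, hPsep, hPcard⟩ := stub_gridCount (D + 1) L hG' hL (0 : EuclideanSpace ℝ (Fin 3))
  have hfin : (Z ∩ Metric.closedBall (0 : EuclideanSpace ℝ (Fin 3)) L).Finite :=
    finite_of_forall_le_dist_of_subset_closedBall (by positivity : (0 : ℝ) < a * (1 - 1 / 50))
      (fun p hp q hq hpq => hsep p hp.1 q hq.1 hpq) Set.inter_subset_right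
  have hW : (↑hfin.toFinset : Set (EuclideanSpace ℝ (Fin 3))) = Z ∩ Metric.closedBall 0 L := hfin.coe_toFinset
  have hAW := hA 0 L (by linarith) hfin.toFinset hW
  have hinj : Set.InjOn φ ↑P := by
    intro y hy y' hy' hyy
    by_contra hne
    have h1 := hPsep y hy y' hy' hne
    have h2 : dist y y' ≤ D + D :=
      calc dist y y' ≤ dist (φ y) y + dist (φ y) y' := dist_triangle_left _ _ _
        _ ≤ D + D := add_le_add (hφd y) (by rw [hyy]; exact hφd y')
    linarith
  have hsub : P.image φ ⊆ hfin.toFinset := by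
    intro p hp
    obtain ⟨y, hy, rfl⟩ := Finset.mem_image.1 hp
    rw [← Finset.mem_coe, hW]
    refine ⟨hφZ y, Metric.mem_closedBall.2 ?_⟩
    have h1 : dist y 0 ≤ L / 2 := Metric.mem_closedBall.1 (hPball (Finset.mem_coe.2 hy))
    linarith [dist_triangle (φ y) y 0, hφd y]
  have hsum : (P.card : ℝ) * (localDefect a Z p₀ / 2) ≤ ∑ p ∈ hfin.toFinset, localDefect a Z p :=
    calc (P.card : ℝ) * (localDefect a Z p₀ / 2)
          = ∑ p ∈ P.image φ, localDefect a Z p₀ / 2 := by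
            rw [Finset.sum_const, nsmul_eq_mul, Finset.card_image_of_injOn hinj]
      _ ≤ ∑ p ∈ P.image φ, localDefect a Z p := Finset.sum_le_sum fun p hp => by
            obtain ⟨y, -, rfl⟩ := Finset.mem_image.1 hp; exact hφη y
      _ ≤ ∑ p ∈ hfin.toFinset, localDefect a Z p :=
            Finset.sum_le_sum_of_subset_of_nonneg hsub fun p _ _ => localDefect_nonneg a Z p
  have hD1 : (0 : ℝ) < 8 * (D + 1) := by positivity
  calc κ * (localDefect a Z p₀ / 2) / (8 * (D + 1)) ^ 3 * L ^ 3
        = κ * ((L / (8 * (D + 1))) ^ 3 * (localDefect a Z p₀ / 2)) := by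
          field_simp
    _ ≤ κ * ((P.card : ℝ) * (localDefect a Z p₀ / 2)) := by gcongr
    _ ≤ κ * ∑ p ∈ hfin.toFinset, localDefect a Z p := by gcongr
    _ ≤ (C + max CU 0 * CB) * L ^ 2 := hAW

end Summit.AtomisticToContinuum.Crystallization.Theorems.CleanHull

end
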